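import Summits.AtomisticToContinuum.FouriersLaw.Theorems.VanishingNoiseTransferVanishingNoiseBoundFixedLengthNoiseContinuityReductions

/-!
# Fixed-length noise continuity from a MIXED Lipschitz bound `|J(με,δ) - J(μ0,δ)| ≤ η ε… |δ|`
(helper for stub S2' `stub_flipResponseEquidifferentiable`, line `fekete-usc-one-length`)

`--supports stmt-AtomisticToContinuum-11976` helper file (crux `VanishingNoiseBound`, route
`VanishingNoiseTransfer`). The reshape r2 of the line's skeleton proves the fixed-length statement
`fixedLengthNoiseContinuity` (`|Dε - D0| ≤ η` for the responses of the unique flip-steady family at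
small flip rate `ε`, ONE length `N`) from the registered stub S2' = input (E): an `ε`-UNIFORM
differentiability modulus at `δ = 0` of the response quotients `J(με,δ)/δ`,
`J(μ,δ) := totalCurrent (μ (T+δ/2) (T-δ/2))` (`FixedLengthNoiseContinuity.of_equidifferentiable`).
Input (E) is second-order-in-`δ` information, uniform in `ε`; this file records, kernel-checked, that
LESS suffices — the Moore–Osgood exchange can be run "the other way":

* `of_mixedLipschitz` — **the conclusion of `fixedLengthNoiseContinuity` from the mixed bound (L)**:
  for every `η > 0` there is `ε₂ > 0` such that for all `ε ∈ (0, ε₂]` and the unique flip-steady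
  family `με`, EVENTUALLY along `δ → 0, δ ≠ 0` (the punctured neighbourhood may depend on `ε`),
  `|J(με,δ) - J(μ0,δ)| ≤ η |δ|`. Given the two response limits (hypotheses of the frame), (L) is in
  fact EQUIVALENT to the conclusion `∀ η, ∃ ε₂, … |Dε - D0| ≤ η`; it mentions no limit and no
  derivative, only the two steady currents at the SAME bath temperatures `T ± δ/2`.
* `mixedLipschitz_of_uniformTransfer` — (L) from a **two-parameter transfer bound (UT)**: constants
  `K, ε₀, δ₀` such that for `0 < |δ| < δ₀` and `0 < ε ≤ ε₀` SOME weak flip steady state `μ` of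
  `L + εS` at `(T+δ/2, T-δ/2)` has `|totalCurrent μ - J(μ0,δ)| ≤ K ε |δ|` (weak flip uniqueness,
  a hypothesis of the frame, identifies `μ` with `με (T+δ/2) (T-δ/2)`). (UT) is the landed
  zeroth-order closeness `|J(με,δ) - J(μ0,δ)| ≤ M(δ) ε` (`flipSteadyState_totalCurrent_near`,
  `…FlipContinuity.lean`) sharpened in two ways: `M` uniform for temperatures near `(T,T)`, and a
  factor `|δ|` — at `δ = 0` both steady states are the Gibbs measure at `T`
  (`totalCurrent_flipSteadyFamily_diag_eq_zero`), and the flip perturbation `εS` moves the steady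
  state only through the flip-ODD part of the deterministic steady state, which is `O(δ)`.
* `of_uniformTransfer` — the composition: the conclusion of `fixedLengthNoiseContinuity` from (UT).

No definitions; real-variable bookkeeping over the frame of the stub only.
-/

noncomputable section

namespace Summit.AtomisticToContinuum.FouriersLaw.Theorems.FixedLengthNoiseContinuity

open MeasureTheory Filter Topology
open Literature.MathematicalPhysics.KineticTheory.HeatConduction

section Reduction

variable {ω₂ lam β γ : ℝ}

/-- **`fixedLengthNoiseContinuity` from the mixed Lipschitz bound (L).** Fix parameters, `T`, `N`,
the deterministic family `μ0` with response `D0` at `T`. If for every `η > 0` there is `ε₂ > 0` such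
that for all `ε ∈ (0, ε₂]` and every unique flip-steady family `με` at rate `ε`, eventually along
`δ → 0, δ ≠ 0`, `|J(με,δ) - J(μ0,δ)| ≤ η |δ|`, then every response `Dε` of such a family satisfies
`|Dε - D0| ≤ η` (`abs_sub_le_of_eventually_abs_sub_le`: divide by `δ` and pass to the limit). -/
theorem of_mixedLipschitz {T : ℝ} {N : ℕ} (μ0 : ℝ → ℝ → Measure (PhaseSpace N)) {D0 : ℝ}
    (hD0 : Tendsto (fun δ : ℝ =>
      (pinnedChain ω₂ lam β γ).totalCurrent (μ0 (T + δ / 2) (T - δ / 2)) / δ) (𝓝[≠] 0) (𝓝 D0))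
    (hL : ∀ η : ℝ, 0 < η → ∃ ε₂ : ℝ, 0 < ε₂ ∧ ∀ ε : ℝ, 0 < ε → ε ≤ ε₂ →
      ∀ με : ℝ → ℝ → Measure (PhaseSpace N),
        (∀ T_L T_R : ℝ, 0 < T_L → 0 < T_R →
          (pinnedChain ω₂ lam β γ).IsFlipSteadyState N T_L T_R ε (με T_L T_R) ∧
            ∀ ν : Measure (PhaseSpace N),
              (pinnedChain ω₂ lam β γ).IsFlipSteadyState N T_L T_R ε ν → ν = με T_L T_R) →
        ∀ᶠ δ in 𝓝[≠] (0 : ℝ),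
          |(pinnedChain ω₂ lam β γ).totalCurrent (με (T + δ / 2) (T - δ / 2)) -
              (pinnedChain ω₂ lam β γ).totalCurrent (μ0 (T + δ / 2) (T - δ / 2))| ≤ η * |δ|) :
    ∀ η : ℝ, 0 < η → ∃ ε₂ : ℝ, 0 < ε₂ ∧ ∀ ε : ℝ, 0 < ε → ε ≤ ε₂ →
      ∀ με : ℝ → ℝ → Measure (PhaseSpace N),
        (∀ T_L T_R : ℝ, 0 < T_L → 0 < T_R →
          (pinnedChain ω₂ lam β γ).IsFlipSteadyState N T_L T_R ε (με T_L T_R) ∧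
            ∀ ν : Measure (PhaseSpace N),
              (pinnedChain ω₂ lam β γ).IsFlipSteadyState N T_L T_R ε ν → ν = με T_L T_R) →
        ∀ Dε : ℝ,
          Tendsto (fun δ : ℝ =>
            (pinnedChain ω₂ lam β γ).totalCurrent (με (T + δ / 2) (T - δ / 2)) / δ)
            (𝓝[≠] 0) (𝓝 Dε) →
          |Dε - D0| ≤ η := by
  intro η hη
  obtain ⟨ε₂, hε₂, h⟩ := hL η hη
  exact ⟨ε₂, hε₂, fun ε hε hεle με hμε Dε hDε =>
    abs_sub_le_of_eventually_abs_sub_le hD0 hDε (h ε hε hεle με hμε)⟩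

/-- **The mixed Lipschitz bound (L) from a uniform two-parameter transfer bound (UT).** If `T > 0`
and there are `K, ε₀ > 0, δ₀ > 0` such that for all `0 < |δ| < δ₀` and `0 < ε ≤ ε₀` some weak flip
steady state `μ` of `L + εS` at the temperatures `(T+δ/2, T-δ/2)` has
`|totalCurrent μ - J(μ0,δ)| ≤ K ε |δ|`, then (L) holds: given `η > 0` take
`ε₂ := min ε₀ (η/(max K 0 + 1))`; for `0 < |δ| < min δ₀ (2T)` both temperatures are positive and
weak flip uniqueness (hypothesis on `με`) identifies `μ` with `με (T+δ/2) (T-δ/2)`. -/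
theorem mixedLipschitz_of_uniformTransfer {T : ℝ} (hT : 0 < T) {N : ℕ}
    (μ0 : ℝ → ℝ → Measure (PhaseSpace N))
    (hUT : ∃ K ε₀ δ₀ : ℝ, 0 < ε₀ ∧ 0 < δ₀ ∧ ∀ δ : ℝ, δ ≠ 0 → |δ| < δ₀ →
      ∀ ε : ℝ, 0 < ε → ε ≤ ε₀ →
        ∃ μ : Measure (PhaseSpace N),
          (pinnedChain ω₂ lam β γ).IsFlipSteadyState N (T + δ / 2) (T - δ / 2) ε μ ∧
            |(pinnedChain ω₂ lam β γ).totalCurrent μ -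
                (pinnedChain ω₂ lam β γ).totalCurrent (μ0 (T + δ / 2) (T - δ / 2))| ≤
              K * ε * |δ|) :
    ∀ η : ℝ, 0 < η → ∃ ε₂ : ℝ, 0 < ε₂ ∧ ∀ ε : ℝ, 0 < ε → ε ≤ ε₂ →
      ∀ με : ℝ → ℝ → Measure (PhaseSpace N),
        (∀ T_L T_R : ℝ, 0 < T_L → 0 < T_R →
          (pinnedChain ω₂ lam β γ).IsFlipSteadyState N T_L T_R ε (με T_L T_R) ∧
            ∀ ν : Measure (PhaseSpace N),
              (pinnedChain ω₂ lam β γ).IsFlipSteadyState N T_L T_R ε ν → ν = με T_L T_R) →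
        ∀ᶠ δ in 𝓝[≠] (0 : ℝ),
          |(pinnedChain ω₂ lam β γ).totalCurrent (με (T + δ / 2) (T - δ / 2)) -
              (pinnedChain ω₂ lam β γ).totalCurrent (μ0 (T + δ / 2) (T - δ / 2))| ≤ η * |δ| := by
  intro η hη
  obtain ⟨K, ε₀, δ₀, hε₀, hδ₀, hUT⟩ := hUT
  set K' : ℝ := max K 0 with hK'
  have hK'0 : 0 ≤ K' := le_max_right _ _
  have hKK' : K ≤ K' := le_max_left _ _
  refine ⟨min ε₀ (η / (K' + 1)), lt_min hε₀ (by positivity), fun ε hε hεle με hμε => ?_⟩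
  have hεle₀ : ε ≤ ε₀ := hεle.trans (min_le_left _ _)
  have hεη : ε ≤ η / (K' + 1) := hεle.trans (min_le_right _ _)
  -- the punctured neighbourhood `0 < |δ| < min δ₀ (2T)`
  have hball : ∀ᶠ δ in 𝓝[≠] (0 : ℝ), |δ| < min δ₀ (2 * T) := by
    have : Metric.ball (0 : ℝ) (min δ₀ (2 * T)) ∈ 𝓝 (0 : ℝ) :=
      Metric.ball_mem_nhds 0 (lt_min hδ₀ (by positivity))
    filter_upwards [mem_nhdsWithin_of_mem_nhds this] with δ hδ
    simpa [Real.dist_eq] using hδ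
  have h0 : ∀ᶠ δ in 𝓝[≠] (0 : ℝ), δ ≠ 0 := eventually_mem_nhdsWithin
  filter_upwards [hball, h0] with δ hδ hδ0
  have hδ₀' : |δ| < δ₀ := hδ.trans_le (min_le_left _ _)
  have hδT : |δ| < 2 * T := hδ.trans_le (min_le_right _ _)
  have h1 : 0 < T + δ / 2 := by
    have := neg_abs_le δ
    linarith
  have h2 : 0 < T - δ / 2 := by
    have := le_abs_self δ
    linarith
  obtain ⟨μ, hμ, hbound⟩ := hUT δ hδ0 hδ₀' ε hε hεle₀
  -- weak flip uniqueness at `(T + δ/2, T - δ/2)`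
  have hμε' : μ = με (T + δ / 2) (T - δ / 2) := (hμε _ _ h1 h2).2 μ hμ
  rw [hμε'] at hbound
  refine hbound.trans ?_
  have hδabs : 0 ≤ |δ| := abs_nonneg δ
  have hKε : K * ε ≤ η := by
    have h3 : K * ε ≤ K' * ε := mul_le_mul_of_nonneg_right hKK' hε.le
    have h4 : K' * ε ≤ K' * (η / (K' + 1)) := mul_le_mul_of_nonneg_left hεη hK'0
    have h5 : K' * (η / (K' + 1)) ≤ η := by
      rw [mul_div_assoc']
      rw [div_le_iff₀ (by positivity)]
      nlinarith
    linarith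
  exact mul_le_mul_of_nonneg_right hKε hδabs

/-- **`fixedLengthNoiseContinuity` from the uniform two-parameter transfer bound (UT)** — the
composition of `mixedLipschitz_of_uniformTransfer` and `of_mixedLipschitz`: for `T > 0`, the
deterministic family `μ0` with response `D0` at `T`, and (UT) (for `0 < |δ| < δ₀`, `0 < ε ≤ ε₀`
some weak flip steady state at `(T+δ/2, T-δ/2)` and rate `ε` has total current within `K ε |δ|` of
`J(μ0,δ)`), every response `Dε` of the unique flip-steady family at small rate is within `η` of
`D0`. After this file the fixed-length noise continuity of the line reduces to (UT), a statement
about ONE flip steady state per `(δ, ε)` at positive temperatures, with no limit in it. -/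
theorem of_uniformTransfer {T : ℝ} (hT : 0 < T) {N : ℕ} (μ0 : ℝ → ℝ → Measure (PhaseSpace N))
    {D0 : ℝ}
    (hD0 : Tendsto (fun δ : ℝ =>
      (pinnedChain ω₂ lam β γ).totalCurrent (μ0 (T + δ / 2) (T - δ / 2)) / δ) (𝓝[≠] 0) (𝓝 D0))
    (hUT : ∃ K ε₀ δ₀ : ℝ, 0 < ε₀ ∧ 0 < δ₀ ∧ ∀ δ : ℝ, δ ≠ 0 → |δ| < δ₀ →
      ∀ ε : ℝ, 0 < ε → ε ≤ ε₀ →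
        ∃ μ : Measure (PhaseSpace N),
          (pinnedChain ω₂ lam β γ).IsFlipSteadyState N (T + δ / 2) (T - δ / 2) ε μ ∧
            |(pinnedChain ω₂ lam β γ).totalCurrent μ -
                (pinnedChain ω₂ lam β γ).totalCurrent (μ0 (T + δ / 2) (T - δ / 2))| ≤
              K * ε * |δ|) :
    ∀ η : ℝ, 0 < η → ∃ ε₂ : ℝ, 0 < ε₂ ∧ ∀ ε : ℝ, 0 < ε → ε ≤ ε₂ →
      ∀ με : ℝ → ℝ → Measure (PhaseSpace N),
        (∀ T_L T_R : ℝ, 0 < T_L → 0 < T_R →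
          (pinnedChain ω₂ lam β γ).IsFlipSteadyState N T_L T_R ε (με T_L T_R) ∧
            ∀ ν : Measure (PhaseSpace N),
              (pinnedChain ω₂ lam β γ).IsFlipSteadyState N T_L T_R ε ν → ν = με T_L T_R) →
        ∀ Dε : ℝ,
          Tendsto (fun δ : ℝ =>
            (pinnedChain ω₂ lam β γ).totalCurrent (με (T + δ / 2) (T - δ / 2)) / δ)
            (𝓝[≠] 0) (𝓝 Dε) →
          |Dε - D0| ≤ η :=
  of_mixedLipschitz μ0 hD0 (mixedLipschitz_of_uniformTransfer hT μ0 hUT)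

end Reduction

/-- Registered helper sub-goal `helper_fixedLengthNoiseContinuityOfUniformTransfer` of
stmt-AtomisticToContinuum-11976 (= `of_uniformTransfer`, fully quantified, notation-free one-line
form): the conclusion of `fixedLengthNoiseContinuity` from the uniform two-parameter transfer bound
(UT). -/
theorem helper_fixedLengthNoiseContinuityOfUniformTransfer : ∀ (ω₂ lam β γ T : ℝ), 0 < T → ∀ (N : ℕ) (μ0 : ℝ → ℝ → MeasureTheory.Measure (Literature.MathematicalPhysics.KineticTheory.HeatConduction.PhaseSpace N)) (D0 : ℝ), Filter.Tendsto (fun δ : ℝ => (Literature.MathematicalPhysics.KineticTheory.HeatConduction.pinnedChain ω₂ lam β γ).totalCurrent (μ0 (T + δ / 2) (T - δ / 2)) / δ) (nhdsWithin 0 {(0 : ℝ)}ᶜ) (nhds D0) → (∃ K ε₀ δ₀ : ℝ, 0 < ε₀ ∧ 0 < δ₀ ∧ ∀ δ : ℝ, δ ≠ 0 → |δ| < δ₀ → ∀ ε : ℝ, 0 < ε → ε ≤ ε₀ → ∃ μ : MeasureTheory.Measure (Literature.MathematicalPhysics.KineticTheory.HeatConduction.PhaseSpace N), (Literature.MathematicalPhysics.KineticTheory.HeatConduction.pinnedChain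 ω₂ lam β γ).IsFlipSteadyState N (T + δ / 2) (T - δ / 2) ε μ ∧ |(Literature.MathematicalPhysics.KineticTheory.HeatConduction.pinnedChain ω₂ lam β γ).totalCurrent μ - (Literature.MathematicalPhysics.KineticTheory.HeatConduction.pinnedChain ω₂ lam β γ).totalCurrent (μ0 (T + δ / 2) (T - δ / 2))| ≤ K * ε * |δ|) → ∀ η : ℝ, 0 < η → ∃ ε₂ : ℝ, 0 < ε₂ ∧ ∀ ε : ℝ, 0 < ε → ε ≤ ε₂ → ∀ με : ℝ → ℝ → MeasureTheory.Measure (Literature.MathematicalPhysics.KineticTheory.HeatConduction.PhaseSpace N), (∀ T_L T_R : ℝ, 0 < T_L → 0 < T_R → (Literature.MathematicalPhysics.KineticTheory.HeatConduction.pinnedChain ω₂ lam β γ).IsFlipSteadyState N T_L T_R ε (με T_L T_R) ∧ ∀ ν : MeasureTheory.Measure (Literature.MathematicalPhysics.KineticTheory.HeatConduction.PhaseSpace N), (Literature.MathematicalPhysics.KineticTheory.HeatConduction.pinnedChain ω₂ lam β γ).IsFlipSteadyState N T_L T_R ε ν → ν = με T_L T_R) → ∀ Dε : ℝ, Filter.Tendsto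 (fun δ : ℝ => (Literature.MathematicalPhysics.KineticTheory.HeatConduction.pinnedChain ω₂ lam β γ).totalCurrent (με (T + δ / 2) (T - δ / 2)) / δ) (nhdsWithin 0 {(0 : ℝ)}ᶜ) (nhds Dε) → |Dε - D0| ≤ η :=
  fun _ _ _ _ _ hT _ μ0 _ hD0 hUT => of_uniformTransfer hT μ0 hD0 hUT

end Summit.AtomisticToContinuum.FouriersLaw.Theorems.FixedLengthNoiseContinuity

end
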